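import Mathlib
import HarnessLib
import Summits.HubbardSuperconductivity.HubbardSuperconductivity.Theorems.KLProgrammeKLRegimeTorusL1ProductBump
import Summits.HubbardSuperconductivity.HubbardSuperconductivity.Theorems.KLProgrammeKLRegimeTorusL1DyadicSuperpositionWt

/-!
# Route `KLProgramme` — engine support (rows E-b2(4)/E-b3, NORM side, brick (T4w)): CANONICAL PRODUCT BUMPS satisfy the THIRD-difference bump hypotheses
# of the one-moment lemma (T1w) with explicit rates — the weighted twin of `…TorusL1ProductBump` (T4)

Cell gate-hubbard-kl, seat hubbard-kl-k3c2-p3 (g17; row «sector-counting import»).  (T4) showed that the canonical product bump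
`G(q) = φ(q̃₁/R₀)·φ((q̃₂)₀/R₁)·φ((q̃₂)₁/R₁)` (`φ ∈ C²`, `|φ| ≤ 1`, `φ = 0` off `(−1,1)`) meets the SECOND-difference data of (T1)/(T2).  The weighted rows of the
(b) closing path ((T1w) `sum_wt_norm_charSum_bump_le`, (T2w) `wplainFourLegLine_of_pairTransfer_superposition`) ask THIRD differences instead.  Same proof with
`norm_fwdDiff_iter_le_of_norm_iteratedDeriv_le 3` and `φ ∈ C³`, `|φ‴| ≤ κ³` (`κ ≥ 1`):

* §1 `abs_fwdDiff_three_rescaled_le` — `|Δ³_1 (s ↦ φ((c+s)/R))(0)| ≤ K/R³` for `|φ‴| ≤ K`;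
* §2 `abs_fwdDiff_three_timeBump_le` (`2R₀ + 6 ≤ P`), `abs_fwdDiff_three_spaceBump_le` (`2R₁ + 6 ≤ L`, `|φ| ≤ 1`);
* §3 **`productBump_thirdDifferences`** — time third difference `≤ K/R₀³`, axis third differences `≤ K/R₁³`;
* §4 **`sum_wt_norm_charSum_productBump_le`** — with `|φ‴| ≤ κ³`, `κ ≥ 1`, `4R₀ ≤ P`, `4R₁ ≤ L`, `2R₀ + 6 ≤ P`, `2R₁ + 6 ≤ L` and ANY weight rates
  `t₀ ≤ 4R₀/(κP)`, `t₁ ≤ 4R₁/(κL)`: `Σ_z (1 + t₀|z̃₁| + t₁|z̃₂,₁| + t₁|z̃₂,₂|)·‖S[G](z)‖ ≤ √(6561988608·κ³)·(P·L²)` — rates `s₀ = 4R₀/(κP)`, `s₁ = 4R₁/(κL)`, `n₀ = κ³`, `A = 1`.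
So a producer of the pair-transfer representation feeding the WEIGHTED rows again supplies only amplitudes and remainders; at level `j` the scale-`i` bumps (`i ≤ j`,
`R₀ ≍ βΛ_i/π`, `R₁ ≍ LΛ_i/2π`) dominate the weight rates `(Λ_jβ/(2M), Λ_j)` once `κ·Λ_j ≤ (8/π)·Λ_i`-type inequalities hold (the producer's choice of radii).
Everything is proved; no definitions; nothing about the model is asserted. [folklore]
References: BGM 2006 §2.8 (2.81) footnote ¹ [cite: BenfattoGiulianiMastropietro2006]; Katznelson, *Harmonic Analysis*, Ch. I §6.3.
-/

noncomputable section

namespace Summit.HubbardSuperconductivity.HubbardSuperconductivity.Theorems.TorusFourierL2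

set_option linter.dupNamespace false -- summit = problem name (single-conjunct summit), D-0017

open Finset Complex Literature.Probability.LatticeModels Literature.Analysis.Calculus
open scoped Real

/-! ### §1 Lattice third differences of a rescaled `C³` profile -/

/-- **Third differences of a rescaled profile**: if `φ` is `C³` with `|φ‴| ≤ K` then `|Δ³_1 (s ↦ φ((c+s)/R)) (0)| ≤ K/R³` (`R > 0`). [cite: Katznelson2004, Ch. I §6.3] -/
theorem abs_fwdDiff_three_rescaled_le (φ : ℝ → ℝ) (hφ : ContDiff ℝ 3 φ) {K : ℝ} (hK : ∀ t, |iteratedDeriv 3 φ t| ≤ K) {R : ℝ} (hR : 0 < R) (c : ℝ) :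
    |((fwdDiff (1 : ℝ))^[3] (fun s => φ ((c + s) / R))) 0| ≤ K / R ^ 3 := by
  set ψ : ℝ → ℝ := fun s => φ (R⁻¹ * (c + s)) with hψdef
  have hψeq : (fun s => φ ((c + s) / R)) = ψ := by
    funext s; simp only [hψdef, div_eq_inv_mul]
  rw [hψeq]
  have hg : ContDiff ℝ 3 (fun x => φ (R⁻¹ * x)) := hφ.comp (contDiff_const.mul contDiff_id)
  have hψc : ContDiff ℝ 3 ψ := hg.comp (contDiff_const.add contDiff_id)
  have hder : ∀ s, iteratedDeriv 3 ψ s = (R⁻¹) ^ 3 * iteratedDeriv 3 φ (R⁻¹ * (c + s)) := by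
    intro s
    have h1 : ψ = fun z => (fun x => φ (R⁻¹ * x)) (c + z) := rfl
    rw [h1, iteratedDeriv_comp_const_add 3 (fun x => φ (R⁻¹ * x)) c]
    show iteratedDeriv 3 (fun x => φ (R⁻¹ * x)) (c + s) = _
    rw [iteratedDeriv_comp_const_mul hφ]
  have hbound : ∀ s ∈ Set.Icc (0 : ℝ) (0 + 3 * 1), ‖iteratedDeriv 3 ψ s‖ ≤ K / R ^ 3 := by
    intro s _
    rw [hder, Real.norm_eq_abs, abs_mul, abs_of_nonneg (by positivity : (0 : ℝ) ≤ (R⁻¹) ^ 3), inv_pow, div_eq_inv_mul]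
    exact mul_le_mul_of_nonneg_left (hK _) (by positivity)
  have h := norm_fwdDiff_iter_le_of_norm_iteratedDeriv_le 3 ψ hψc (h := 1) zero_le_one 0 (K := K / R ^ 3) (by simpa using hbound)
  rw [one_pow, one_mul, Real.norm_eq_abs] at h
  exact h

/-! ### §2 The time factor on `(ℤ/P)¹` and the space factor on `(ℤ/L)²`: pointwise third differences, no wrap -/

/-- **Time factor, order three**: for `2R₀ + 6 ≤ P`, the third difference of `a ↦ φ(ã₀/R₀)` along `(1)` is `≤ K/R₀³` pointwise. [cite: Katznelson2004, Ch. I §6.3] -/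
theorem abs_fwdDiff_three_timeBump_le {P : ℕ} [NeZero P] (φ : ℝ → ℝ) (hφ : ContDiff ℝ 3 φ) {K : ℝ} (hK : ∀ t, |iteratedDeriv 3 φ t| ≤ K)
    (hφ0 : ∀ t, 1 ≤ |t| → φ t = 0) {R₀ : ℕ} (hR₀ : 0 < R₀) (hP : 2 * R₀ + 6 ≤ P) (a : TorusSite 1 P) :
    |((fwdDiff (fun _ : Fin 1 => (1 : ZMod P)))^[3] (fun b : TorusSite 1 P => φ (((b 0).valMinAbs : ℝ) / R₀))) a| ≤ K / (R₀ : ℝ) ^ 3 := by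
  set f : (Fin 1 → ℤ) → ℝ := fun m => φ ((m 0 : ℝ) / R₀) with hf
  have hsupp : ∀ m : Fin 1 → ℤ, (∃ j, (P : ℤ) ≤ 2 * |m j| + 2 * (3 : ℕ) * |(fun _ : Fin 1 => (1 : ℤ)) j|) → f m = 0 := by
    rintro m ⟨j, hj⟩
    have hj0 : j = 0 := Subsingleton.elim _ _
    subst hj0
    simp only [abs_one, mul_one] at hj
    have hm : (R₀ : ℤ) ≤ |m 0| := by push_cast at hj hP ⊢; omega
    simp only [hf]
    refine hφ0 _ ?_
    have hR' : (0 : ℝ) < R₀ := by exact_mod_cast hR₀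
    rw [abs_div, abs_of_pos hR', le_div_iff₀ hR', one_mul]
    exact_mod_cast hm
  have hsec := fwdDiff_iter_comp_section (P := P) (fun x : ZMod P => x.valMinAbs) f (fun _ : Fin 1 => (1 : ℤ)) 3
    (fun b t ht => section_consistent_valMinAbs f (fun _ : Fin 1 => (1 : ℤ)) 3 hsupp b t ht) a
  have hcast : (fun j : Fin 1 => (((fun _ : Fin 1 => (1 : ℤ)) j : ℤ) : ZMod P)) = fun _ : Fin 1 => (1 : ZMod P) := by
    funext j; simp
  rw [hcast] at hsec
  have hfeq : (fun b : TorusSite 1 P => f (fun j => (b j).valMinAbs)) = fun b : TorusSite 1 P => φ (((b 0).valMinAbs : ℝ) / R₀) := by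
    funext b; simp only [hf]
  rw [hfeq] at hsec
  rw [hsec]
  have hline := fwdDiff_iter_eq_of_line f (fun _ : Fin 1 => (1 : ℤ)) (fun j => (a j).valMinAbs)
    (fun s => φ ((((a 0).valMinAbs : ℝ) + s) / R₀)) (fun k => by simp [hf]) 3
  rw [hline]
  exact abs_fwdDiff_three_rescaled_le φ hφ hK (by exact_mod_cast hR₀) _

/-- **Space factor, order three**: for `2R₁ + 6 ≤ L`, the third differences of `b ↦ φ(b̃₀/R₁)φ(b̃₁/R₁)` along the two axes are `≤ K/R₁³` pointwise (`|φ| ≤ 1`).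
[cite: Katznelson2004, Ch. I §6.3] -/
theorem abs_fwdDiff_three_spaceBump_le {L : ℕ} [NeZero L] (φ : ℝ → ℝ) (hφ : ContDiff ℝ 3 φ) {K : ℝ} (hK : ∀ t, |iteratedDeriv 3 φ t| ≤ K)
    (hφ1 : ∀ t, |φ t| ≤ 1) (hφ0 : ∀ t, 1 ≤ |t| → φ t = 0) {R₁ : ℕ} (hR₁ : 0 < R₁) (hL : 2 * R₁ + 6 ≤ L) (b : TorusSite 2 L) (i : Fin 2) :
    |((fwdDiff (Pi.single i (1 : ZMod L) : TorusSite 2 L))^[3]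
        (fun b : TorusSite 2 L => φ (((b 0).valMinAbs : ℝ) / R₁) * φ (((b 1).valMinAbs : ℝ) / R₁))) b| ≤ K / (R₁ : ℝ) ^ 3 := by
  have hR' : (0 : ℝ) < R₁ := by exact_mod_cast hR₁
  have hK0 : 0 ≤ K := (abs_nonneg _).trans (hK 0)
  set f : (Fin 2 → ℤ) → ℝ := fun m => φ ((m 0 : ℝ) / R₁) * φ ((m 1 : ℝ) / R₁) with hf
  set v : Fin 2 → ℤ := Pi.single i 1 with hv
  have hvan : ∀ m : Fin 2 → ℤ, ∀ j, (R₁ : ℤ) ≤ |m j| → f m = 0 := by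
    intro m j hj
    have hj2 : j = 0 ∨ j = 1 := by fin_cases j <;> simp
    rcases hj2 with rfl | rfl
    · have hz : φ ((m 0 : ℝ) / R₁) = 0 := by
        refine hφ0 _ ?_
        rw [abs_div, abs_of_pos hR', le_div_iff₀ hR', one_mul]; exact_mod_cast hj
      simp only [hf, hz, zero_mul]
    · have hz : φ ((m 1 : ℝ) / R₁) = 0 := by
        refine hφ0 _ ?_
        rw [abs_div, abs_of_pos hR', le_div_iff₀ hR', one_mul]; exact_mod_cast hj
      simp only [hf, hz, mul_zero]
  have hsupp : ∀ m : Fin 2 → ℤ, (∃ j, (L : ℤ) ≤ 2 * |m j| + 2 * (3 : ℕ) * |v j|) → f m = 0 := by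
    rintro m ⟨j, hj⟩
    refine hvan m j ?_
    have hvj : |v j| ≤ 1 := by
      simp only [hv, Pi.single_apply]
      split_ifs <;> simp
    push_cast at hj hL ⊢
    nlinarith [hvj, abs_nonneg (v j), abs_nonneg (m j)]
  have hsec := fwdDiff_iter_comp_section (P := L) (fun x : ZMod L => x.valMinAbs) f v 3
    (fun b t ht => section_consistent_valMinAbs f v 3 hsupp b t ht) b
  have hcast : (fun j : Fin 2 => ((v j : ℤ) : ZMod L)) = (Pi.single i (1 : ZMod L) : TorusSite 2 L) := by
    funext j; simp only [hv, Pi.single_apply]; split_ifs <;> simp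
  rw [hcast] at hsec
  have hfeq : (fun b : TorusSite 2 L => f (fun j => (b j).valMinAbs)) =
      fun b : TorusSite 2 L => φ (((b 0).valMinAbs : ℝ) / R₁) * φ (((b 1).valMinAbs : ℝ) / R₁) := by
    funext b; simp only [hf]
  rw [hfeq] at hsec
  rw [hsec]
  set m : Fin 2 → ℤ := fun j => (b j).valMinAbs with hm
  fin_cases i
  · have hline := fwdDiff_iter_eq_of_line f v m (fun s => φ (((m 0 : ℝ) + s) / R₁) * φ ((m 1 : ℝ) / R₁)) (fun k => by
        simp [hf, hv]) 3
    rw [hline, fwdDiff_iter_mul_const_real, abs_mul]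
    calc |((fwdDiff (1 : ℝ))^[3] (fun s => φ (((m 0 : ℝ) + s) / R₁))) 0| * |φ ((m 1 : ℝ) / R₁)|
        ≤ K / (R₁ : ℝ) ^ 3 * 1 := mul_le_mul (abs_fwdDiff_three_rescaled_le φ hφ hK hR' _) (hφ1 _) (abs_nonneg _) (by positivity)
      _ = K / (R₁ : ℝ) ^ 3 := mul_one _
  · have hline := fwdDiff_iter_eq_of_line f v m (fun s => φ ((m 0 : ℝ) / R₁) * φ (((m 1 : ℝ) + s) / R₁)) (fun k => by
        simp [hf, hv]) 3
    rw [hline, fwdDiff_iter_const_mul_real, abs_mul]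
    calc |φ ((m 0 : ℝ) / R₁)| * |((fwdDiff (1 : ℝ))^[3] (fun s => φ (((m 1 : ℝ) + s) / R₁))) 0|
        ≤ 1 * (K / (R₁ : ℝ) ^ 3) := mul_le_mul (hφ1 _) (abs_fwdDiff_three_rescaled_le φ hφ hK hR' _) (abs_nonneg _) zero_le_one
      _ = K / (R₁ : ℝ) ^ 3 := one_mul _

/-! ### §3 The product bump: third differences -/

/-- **Third differences of the canonical product bump** `G(q) = φ(q̃₁/R₀)·φ((q̃₂)₀/R₁)·φ((q̃₂)₁/R₁)` (`φ ∈ C³`, `|φ‴| ≤ K`, `|φ| ≤ 1`, `φ = 0` off `(−1,1)`):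
time third difference `≤ K/R₀³` (`2R₀ + 6 ≤ P`); axis third differences `≤ K/R₁³` (`2R₁ + 6 ≤ L`). [cite: Katznelson2004, Ch. I §6.3] -/
theorem productBump_thirdDifferences {P L : ℕ} [NeZero P] [NeZero L] (φ : ℝ → ℝ) (hφ : ContDiff ℝ 3 φ) {K : ℝ}
    (hK : ∀ t, |iteratedDeriv 3 φ t| ≤ K) (hφ1 : ∀ t, |φ t| ≤ 1) (hφ0 : ∀ t, 1 ≤ |t| → φ t = 0)
    {R₀ R₁ : ℕ} (hR₀ : 0 < R₀) (hR₁ : 0 < R₁) (hP : 2 * R₀ + 6 ≤ P) (hL : 2 * R₁ + 6 ≤ L) :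
    let G : TorusSite 1 P × TorusSite 2 L → ℂ := fun q =>
      ((φ (((q.1 0).valMinAbs : ℝ) / R₀) * (φ (((q.2 0).valMinAbs : ℝ) / R₁) * φ (((q.2 1).valMinAbs : ℝ) / R₁)) : ℝ) : ℂ)
    (∀ q, ‖(fwdDiff ((fun _ : Fin 1 => (1 : ZMod P)), (0 : TorusSite 2 L)))^[3] G q‖ ≤ K / (R₀ : ℝ) ^ 3) ∧
    (∀ q (i : Fin 2), ‖(fwdDiff ((0 : TorusSite 1 P), (Pi.single i (1 : ZMod L) : TorusSite 2 L)))^[3] G q‖ ≤ K / (R₁ : ℝ) ^ 3) := by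
  classical
  intro G
  set T : TorusSite 1 P → ℝ := fun a => φ (((a 0).valMinAbs : ℝ) / R₀) with hT
  set S : TorusSite 2 L → ℝ := fun b => φ (((b 0).valMinAbs : ℝ) / R₁) * φ (((b 1).valMinAbs : ℝ) / R₁) with hS
  have hG : ∀ q, G q = ((T q.1 * S q.2 : ℝ) : ℂ) := fun q => rfl
  have hT1 : ∀ a, |T a| ≤ 1 := fun a => hφ1 _
  have hS1 : ∀ b, |S b| ≤ 1 := fun b => by
    rw [hS, abs_mul]
    exact mul_le_one₀ (hφ1 _) (abs_nonneg _) (hφ1 _)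
  have hK0' : 0 ≤ K := (abs_nonneg _).trans (hK 0)
  refine ⟨fun q => ?_, fun q i => ?_⟩
  · have h1 : ((fwdDiff ((fun _ : Fin 1 => (1 : ZMod P)), (0 : TorusSite 2 L)))^[3] G) q =
        ((((fwdDiff (fun _ : Fin 1 => (1 : ZMod P)))^[3] T) q.1 * S q.2 : ℝ) : ℂ) := by
      rw [fwdDiff_iter_prod_fst]
      have hfun : (fun a : TorusSite 1 P => G (a, q.2)) = fun a => ((T a * S q.2 : ℝ) : ℂ) := funext fun a => hG (a, q.2)
      rw [hfun]
      have hco : ∀ (n : ℕ) (g : TorusSite 1 P → ℝ) (a : TorusSite 1 P),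
          ((fwdDiff (fun _ : Fin 1 => (1 : ZMod P)))^[n] (fun a => ((g a : ℝ) : ℂ))) a =
            ((((fwdDiff (fun _ : Fin 1 => (1 : ZMod P)))^[n] g) a : ℝ) : ℂ) := by
        intro n g a
        rw [fwdDiff_iter_eq_sum_shift, fwdDiff_iter_eq_sum_shift]
        push_cast
        refine sum_congr rfl fun k _ => ?_
        simp [zsmul_eq_mul]
      rw [hco, fwdDiff_iter_mul_const_real]
    rw [h1, Complex.norm_real, Real.norm_eq_abs, abs_mul]
    have hK0 : 0 ≤ K / (R₀ : ℝ) ^ 3 := div_nonneg hK0' (by positivity)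
    calc |((fwdDiff (fun _ : Fin 1 => (1 : ZMod P)))^[3] T) q.1| * |S q.2| ≤ K / (R₀ : ℝ) ^ 3 * 1 :=
          mul_le_mul (abs_fwdDiff_three_timeBump_le φ hφ hK hφ0 hR₀ hP q.1) (hS1 _) (abs_nonneg _) hK0
      _ = K / (R₀ : ℝ) ^ 3 := mul_one _
  · have h1 : ((fwdDiff ((0 : TorusSite 1 P), (Pi.single i (1 : ZMod L) : TorusSite 2 L)))^[3] G) q =
        (((T q.1 * ((fwdDiff (Pi.single i (1 : ZMod L) : TorusSite 2 L))^[3] S) q.2 : ℝ)) : ℂ) := by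
      rw [fwdDiff_iter_prod_snd]
      have hfun : (fun b : TorusSite 2 L => G (q.1, b)) = fun b => ((T q.1 * S b : ℝ) : ℂ) := funext fun b => hG (q.1, b)
      rw [hfun]
      have hco : ∀ (n : ℕ) (g : TorusSite 2 L → ℝ) (b : TorusSite 2 L),
          ((fwdDiff (Pi.single i (1 : ZMod L) : TorusSite 2 L))^[n] (fun b => ((g b : ℝ) : ℂ))) b =
            ((((fwdDiff (Pi.single i (1 : ZMod L) : TorusSite 2 L))^[n] g) b : ℝ) : ℂ) := by
        intro n g b
        rw [fwdDiff_iter_eq_sum_shift, fwdDiff_iter_eq_sum_shift]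
        push_cast
        refine sum_congr rfl fun k _ => ?_
        simp [zsmul_eq_mul]
      rw [hco, fwdDiff_iter_const_mul_real]
    rw [h1, Complex.norm_real, Real.norm_eq_abs, abs_mul]
    have hK0 : 0 ≤ K / (R₁ : ℝ) ^ 3 := div_nonneg hK0' (by positivity)
    calc |T q.1| * |((fwdDiff (Pi.single i (1 : ZMod L) : TorusSite 2 L))^[3] S) q.2| ≤ 1 * (K / (R₁ : ℝ) ^ 3) :=
          mul_le_mul (hT1 _) (abs_fwdDiff_three_spaceBump_le φ hφ hK hφ1 hφ0 hR₁ hL q.2 i) (abs_nonneg _) zero_le_one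
      _ = K / (R₁ : ℝ) ^ 3 := one_mul _

/-! ### §4 The one-moment weighted `ℓ¹` norm of the canonical product bump is `O(1)` at every scale -/

/-- **The one-moment weighted `ℓ¹` norm of the canonical product bump is `O(1)` at every weight rate below its own**: with `φ ∈ C³`, `|φ″| ≤ K₂` (any bound),
`|φ‴| ≤ κ³` (`κ ≥ 1`), `|φ| ≤ 1`, `φ = 0` off `(−1,1)`, radii `R₀, R₁ ≥ 1` with `4R₀ ≤ P`, `4R₁ ≤ L`, `2R₀ + 6 ≤ P`, `2R₁ + 6 ≤ L`, and weight rates `t₀ ≤ 4R₀/(κP)`,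
`t₁ ≤ 4R₁/(κL)`: `Σ_z (1 + t₀|z̃₁| + t₁|z̃₂,₁| + t₁|z̃₂,₂|)·‖Σ_q χ_{q₁}(z₁)χ_{q₂}(z₂)•G(q)‖ ≤ √(6561988608·κ³)·(P·L²)`. [cite: Katznelson2004, Ch. I §6.3] -/
theorem sum_wt_norm_charSum_productBump_le {P L : ℕ} [NeZero P] [NeZero L] (φ : ℝ → ℝ) (hφ : ContDiff ℝ 3 φ) {K₂ : ℝ}
    (hK2 : ∀ t, |iteratedDeriv 2 φ t| ≤ K₂) {κ : ℝ} (hκ1 : 1 ≤ κ)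
    (hK : ∀ t, |iteratedDeriv 3 φ t| ≤ κ ^ 3) (hφ1 : ∀ t, |φ t| ≤ 1) (hφ0 : ∀ t, 1 ≤ |t| → φ t = 0)
    {R₀ R₁ : ℕ} (hR₀ : 0 < R₀) (hR₁ : 0 < R₁) (hP : 4 * R₀ ≤ P) (hL : 4 * R₁ ≤ L) (hP' : 2 * R₀ + 6 ≤ P) (hL' : 2 * R₁ + 6 ≤ L)
    {t₀ t₁ : ℝ} (ht₀ : t₀ ≤ 4 * R₀ / (κ * P)) (ht₁ : t₁ ≤ 4 * R₁ / (κ * L)) :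
    ∑ z : TorusSite 1 P × TorusSite 2 L,
      (1 + t₀ * |(((z.1 0).valMinAbs : ℤ) : ℝ)| + t₁ * |(((z.2 0).valMinAbs : ℤ) : ℝ)| + t₁ * |(((z.2 1).valMinAbs : ℤ) : ℝ)|) *
        ‖∑ q : TorusSite 1 P × TorusSite 2 L, (torusChar q.1 z.1 * torusChar q.2 z.2) •
          (((φ (((q.1 0).valMinAbs : ℝ) / R₀) * (φ (((q.2 0).valMinAbs : ℝ) / R₁) * φ (((q.2 1).valMinAbs : ℝ) / R₁)) : ℝ) : ℂ))‖ ≤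
      Real.sqrt (6561988608 * κ ^ 3) * ((P : ℝ) * (L : ℝ) ^ 2) := by
  have hP2 : 2 * R₀ + 4 ≤ P := by omega
  have hL2 : 2 * R₁ + 4 ≤ L := by omega
  have hφ2 : ContDiff ℝ 2 φ := hφ.of_le (by norm_num)
  obtain ⟨hsup, hsupp, -, -⟩ := productBump_bumpData (P := P) (L := L) φ hφ2 hK2 hφ1 hφ0 hR₀ hR₁ hP2 hL2
  obtain ⟨h₀, h₁⟩ := productBump_thirdDifferences (P := P) (L := L) φ hφ hK hφ1 hφ0 hR₀ hR₁ hP' hL'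
  have hκ0 : 0 < κ := lt_of_lt_of_le one_pos hκ1
  have hPpos : (0 : ℝ) < P := by exact_mod_cast lt_of_lt_of_le (by omega : 0 < 4 * R₀) hP
  have hLpos : (0 : ℝ) < L := by exact_mod_cast lt_of_lt_of_le (by omega : 0 < 4 * R₁) hL
  have hR₀' : (0 : ℝ) < R₀ := by exact_mod_cast hR₀
  have hR₁' : (0 : ℝ) < R₁ := by exact_mod_cast hR₁
  -- rates
  set s₀ : ℝ := 4 * R₀ / (κ * P) with hs₀
  set s₁ : ℝ := 4 * R₁ / (κ * L) with hs₁
  have hs₀pos : 0 < s₀ := by positivity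
  have hs₁pos : 0 < s₁ := by positivity
  have hs₀1 : s₀ ≤ 1 := by
    rw [hs₀, div_le_one (by positivity)]
    have : (4 * R₀ : ℝ) ≤ P := by exact_mod_cast hP
    nlinarith
  have hs₁1 : s₁ ≤ 1 := by
    rw [hs₁, div_le_one (by positivity)]
    have : (4 * R₁ : ℝ) ≤ L := by exact_mod_cast hL
    nlinarith
  have hκne : κ ≠ 0 := hκ0.ne'
  have hs₀P : s₀ * P = 4 * R₀ / κ := by rw [hs₀]; field_simp
  have hs₁L : s₁ * L = 4 * R₁ / κ := by rw [hs₁]; field_simp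
  -- the third-difference hypotheses in rate form: `κ³/R³ = 1·(4/(s·P))³`
  have h4₀ : 4 / (s₀ * P) = κ / R₀ := by
    rw [hs₀P, div_div_eq_mul_div, div_eq_div_iff (by positivity) hR₀'.ne']
    ring
  have h4₁ : 4 / (s₁ * L) = κ / R₁ := by
    rw [hs₁L, div_div_eq_mul_div, div_eq_div_iff (by positivity) hR₁'.ne']
    ring
  have hrate₀ : κ ^ 3 / (R₀ : ℝ) ^ 3 = 1 * (4 / (s₀ * P)) ^ 3 := by rw [h4₀, div_pow, one_mul]
  have hrate₁ : κ ^ 3 / (R₁ : ℝ) ^ 3 = 1 * (4 / (s₁ * L)) ^ 3 := by rw [h4₁, div_pow, one_mul]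
  -- support in rate form: `64 R₀ R₁² = κ³·(s₀P)(s₁L)²`
  have hNs : ((64 * R₀ * R₁ ^ 2 : ℕ) : ℝ) ≤ κ ^ 3 * (s₀ * P) * (s₁ * L) ^ 2 := by
    rw [hs₀P, hs₁L]
    have hKK : κ ^ 3 * (4 * (R₀ : ℝ) / κ) * (4 * (R₁ : ℝ) / κ) ^ 2 = 64 * R₀ * R₁ ^ 2 := by
      field_simp
      ring
    rw [hKK]
    push_cast
    exact le_rfl
  have h := sum_wt_norm_charSum_bump_le _ hs₀pos hs₀1 hs₁pos hs₁1 ht₀ ht₁ zero_le_one (by positivity) hNs hsupp hsup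
    (fun q => (h₀ q).trans (le_of_eq hrate₀)) (fun q i => (h₁ q i).trans (le_of_eq hrate₁))
  exact h.trans (le_of_eq (mul_one _))

end Summit.HubbardSuperconductivity.HubbardSuperconductivity.Theorems.TorusFourierL2

end
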